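/-
Copyright (c) 2026 the pub-hodgecm-mathlib formalisation cell (harness21).  Prover seat hodgecm-mathlib-LH4-p01 (g6): LH4-plan (g6) WORD #26 «CAYLEY LEVEL SHIFT»
(the scalar core of mechanism M5 «Cayley ∕ Möbius level shift by `ord_w 2`» of census F0P3a-p06 (g17) `DUNR-H2-CENSUS` §3); 2026-09-02.
-/
import Mathlib.Topology.Algebra.Valued.ValuationTopology
import Mathlib.Algebra.Order.GroupWithZero.Canonical
import HarnessLib

/-!
# The CAYLEY LEVEL SHIFT: `x ↦ (1 + x)∕(1 − x)` maps the ball `|x| ≤ r` (`r < 1`) bijectively onto `|y − 1| ≤ |2|·r`, with inverse `y ↦ (y − 1)∕(y + 1)`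
# (any valued field; at residue characteristic 2 every level is shifted by `ord 2`; Serre, *Local Fields* IV §2, V §3; O'Meara §63)

Topic `NumberTheory/LocalFields`; namespace `Literature.NumberTheory.LocalFields`.  THEOREMS ONLY (no definition, no instance, no notation, no named fact, no `sorry`);
define-free, CM-free, Mathlib-only imports; kernel lane `--supports stmt-HodgeConjecture-24833`.  Cell `pub/hodgecm-mathlib` (D-0151), crux H413 =
`stmt-HodgeConjecture-24833`, half A line LH4 (dyadic pay-down leaf `Cruxes/H413/Lines/F0_P3c_DyadicPaydown.lean`, organs (D-UNR)∕(D-RAM) PRINT by ruling D74′);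
LH4-plan (g6) WORD #26: the scalar core of census mechanism M5 — «the Cayley transform is still a bijection near `1` at residue characteristic `2` but shifts levels by
`ord_w 2` (`(1+X)(1−X)⁻¹ − 1 = 2X(1−X)⁻¹`): every «level `j` ↔ level `j`» literal becomes «level `j` ↔ level `j + ord_w 2`»».  HONEST READER LABEL: BANKED base layer,
consumers none live (the M5 consumer re-bases are undealt); HC_CM is proved only modulo the 7 printed citations (2 remaining named inputs: hLiu418 =
stmt-HodgeConjecture-24832, h413 = stmt-HodgeConjecture-24833) until rung 0 closes; unconditional elementary algebra, count-neutral, pays no letter by itself.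

TAME NEIGHBOURS (cited, not restated; all carry `|2| = 1`): ★ `Automorphic/SplitTorusCayleyShiftValued` §3 (`valued_add_one_eq_one`, `valued_shift_cayleyParam_le_one`,
`valued_one_sub_eq_one_and_of_map_eq_neg`, `valued_cayley_sub_cayley` — the SHIFTED parameter `ϖ⁻¹(x − 1)(x + 1)⁻¹`), ★ `Automorphic/SplitTorusOrderCayleyShift` (2-free
algebra `cayley_sub_cayley`, `map_cayley_mul_cayley`, `map_cayleyParam_eq_neg`; `valuation_cayley_sub_cayley` with `h2 : |2| = 1`), ★ `Automorphic/MatrixMoebiusShiftLevel{,Generic}`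
(`valued_moebius_sub_one_le_of_level … (h2 : |2| = 1)`, 2 × 2 matrices); `|2| ≤ 1` itself is ★ `UnitaryGroup.valued_v_two_le_one`
(`Automorphic/UnitaryThreeRegularUnipotentOrbitFrameDyadic`, not imported here — this file never needs it).  No `LocalFields/` file mentions the Cayley map (census `rg`, 2026-09-02 14:00Z).

CONTENTS (`K` a field; §1–§3 `Valued K Γ₀` for ANY linearly ordered `Γ₀`; §4 `Valued K ℤᵐ⁰`):
* §0 (no valuation) `cayley_sub_one` (`(1+x)∕(1−x) − 1 = 2x∕(1−x)`), `cayley_add_one` (`= 2∕(1−x)`), `one_add_invCayley` (`1 + (y−1)∕(y+1) = 2y∕(y+1)`), `one_sub_invCayley`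
  (`= 2∕(y+1)`), and the two inversion identities `invCayley_cayley` (`1 − x ≠ 0`, `2 ≠ 0`), `cayley_invCayley` (`y + 1 ≠ 0`, `2 ≠ 0`).
* §1 (C1) **`valued_cayley_sub_one`**: `|x| < 1 ⇒ |(1+x)∕(1−x) − 1| = |2|·|x|`; `valued_cayley_add_one` (`= |2|`), `valued_cayley_eq_one` (`|(1+x)∕(1−x)| = 1`),
  `valued_cayley_sub_one_lt_two` (`< |2|` when `2 ≠ 0`).
* §2 (C2) **`valued_invCayley`**: `|y − 1| < |2| ⇒ |(y−1)∕(y+1)| = |y − 1| ∕ |2|` (and `valued_add_one_eq_two`: `|y + 1| = |2|`), `valued_invCayley_lt_one`; the maps are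
  mutually inverse on these balls: `invCayley_cayley_of_valued_lt_one`, `cayley_invCayley_of_valued_sub_one_lt_two`.
* §3 (C3) LEVELS, any `r < 1` in `Γ₀`: `valued_cayley_sub_one_le_mul` (`|x| ≤ r ⇒ |c(x) − 1| ≤ |2|·r`), `valued_invCayley_le_of_le_mul` (converse direction, `2 ≠ 0`),
  **`bijOn_cayley_level`**: `Set.BijOn (x ↦ (1+x)∕(1−x)) {x | |x| ≤ r} {y | |y − 1| ≤ |2|·r}`, `image_cayley_level`, and the ball version **`bijOn_cayley_ball`**:
  `{|x| < 1} → {|y − 1| < |2|}`.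
* §3b (C4) DIFFERENCES **`valued_cayley_sub_cayley_of_lt_one`**: `|c(xᵢ) − c(xⱼ)| = |2|·|xᵢ − xⱼ|` (`|xᵢ|, |xⱼ| < 1`) — every root distance is shifted by `ord 2` (dyadic twin of
  ★ `Automorphic.valued_cayley_sub_cayley`); `valued_invCayley_sub_invCayley` (`= |yᵢ − yⱼ| ∕ |2|`).
* §3c (C1′) `valued_add_one_le_max` (`|x + 1| ≤ max |2| |x − 1|` — all that survives of the tame `|x + 1| = 1`); (C5) `valued_one_sub_eq_valued_one_add_of_map_eq_neg` (a skew `Z`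
  has `|1 − Z| = |1 + Z|` at any residue characteristic), `valued_one_sub_eq_one_and_iff_of_map_eq_neg` (the honest iff: both `= 1` iff `|1 + Z| = 1` — fails for `Z ≡ 1` at
  `|2| < 1`), `valued_one_sub_and_one_add_eq_one_of_lt_one` (`|Z| < 1` suffices, `σ`-free).
* §4 (C3 in `ℤᵐ⁰`, `|2| = exp(−e)`, `1 ≤ j`) **`bijOn_cayley_level_exp`**: `{|x| ≤ exp(−j)} → {|y − 1| ≤ exp(−(j + e))}` — «level `j` ↔ level `j + ord 2`» — with the two
  pointwise directions `valued_cayley_sub_one_le_exp`, `valued_invCayley_le_exp`; (C4) the TAME shape `|2| = 1`: `valued_cayley_sub_one_of_two` (`|c(x) − 1| = |x|`) and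
  `bijOn_cayley_level_of_two` (levels preserved) — the scalar statement behind the tame neighbours above.

## References
* [Serre1979] J.-P. Serre, *Local Fields*, GTM 67 (1979): Ch. IV §2 (the filtration `U⁽ⁿ⁾ = 1 + 𝔭ⁿ`), Ch. V §3.
* [Omeara1963] O. T. O'Meara, *Introduction to Quadratic Forms*, Grundlehren 117 (1963): §63 (dyadic local fields: `|2| < 1`, unit filtrations and the local square theorem 63:1).
-/

set_option autoImplicit false

noncomputable section

open scoped Valued
open WithZero

namespace Literature.NumberTheory.LocalFields

/-! ## §0 Field algebra of the Cayley map `c(x) = (1 + x)∕(1 − x)` and its inverse `y ↦ (y − 1)∕(y + 1)` -/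

section Algebra

variable {K : Type*} [Field K]

/-- `(1 + x)∕(1 − x) − 1 = 2x∕(1 − x)` (`1 − x ≠ 0`). [cite: Omeara1963, §63] -/
theorem cayley_sub_one {x : K} (hx : 1 - x ≠ 0) : (1 + x) / (1 - x) - 1 = 2 * x / (1 - x) := by
  field_simp
  ring

/-- `(1 + x)∕(1 − x) + 1 = 2∕(1 − x)` (`1 − x ≠ 0`). [cite: Omeara1963, §63] -/
theorem cayley_add_one {x : K} (hx : 1 - x ≠ 0) : (1 + x) / (1 - x) + 1 = 2 / (1 - x) := by
  field_simp
  ring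

/-- `1 + (y − 1)∕(y + 1) = 2y∕(y + 1)` (`y + 1 ≠ 0`). [cite: Omeara1963, §63] -/
theorem one_add_invCayley {y : K} (hy : y + 1 ≠ 0) : 1 + (y - 1) / (y + 1) = 2 * y / (y + 1) := by
  field_simp
  ring

/-- `1 − (y − 1)∕(y + 1) = 2∕(y + 1)` (`y + 1 ≠ 0`). [cite: Omeara1963, §63] -/
theorem one_sub_invCayley {y : K} (hy : y + 1 ≠ 0) : 1 - (y - 1) / (y + 1) = 2 / (y + 1) := by
  field_simp
  ring

/-- LEFT INVERSE: `(c(x) − 1)∕(c(x) + 1) = x` for `c(x) = (1 + x)∕(1 − x)`, `1 − x ≠ 0`, `2 ≠ 0`. [cite: Omeara1963, §63] -/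
theorem invCayley_cayley {x : K} (hx : 1 - x ≠ 0) (h2 : (2 : K) ≠ 0) :
    ((1 + x) / (1 - x) - 1) / ((1 + x) / (1 - x) + 1) = x := by
  rw [cayley_sub_one hx, cayley_add_one hx]
  field_simp

/-- RIGHT INVERSE: `c((y − 1)∕(y + 1)) = y` for `y + 1 ≠ 0`, `2 ≠ 0`. [cite: Omeara1963, §63] -/
theorem cayley_invCayley {y : K} (hy : y + 1 ≠ 0) (h2 : (2 : K) ≠ 0) :
    (1 + (y - 1) / (y + 1)) / (1 - (y - 1) / (y + 1)) = y := by
  rw [one_add_invCayley hy, one_sub_invCayley hy]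
  field_simp

end Algebra

/-! ## §1 (C1) `|c(x) − 1| = |2|·|x|` on the ball `|x| < 1` -/

section Valued

variable {K : Type*} [Field K] {Γ₀ : Type*} [LinearOrderedCommGroupWithZero Γ₀] [Valued K Γ₀]

/-- `|x| < 1 ⇒ 1 − x ≠ 0` (indeed `|1 − x| = 1`). [cite: Serre1979, Ch. IV §2] -/
theorem one_sub_ne_zero_of_valued_lt_one {x : K} (hx : Valued.v x < 1) : 1 - x ≠ 0 := fun h0 => by
  have h := Valuation.map_one_sub_of_lt Valued.v hx
  rw [h0, map_zero] at h
  exact zero_ne_one h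

/-- **(C1) `|(1 + x)∕(1 − x) − 1| = |2|·|x|`** for `|x| < 1` (`(1+x)∕(1−x) − 1 = 2x∕(1−x)` and `|1 − x| = 1`): the Cayley map shifts the level of `x` by `ord 2`.
[cite: Omeara1963, §63] [cite: Serre1979, Ch. IV §2] -/
theorem valued_cayley_sub_one {x : K} (hx : Valued.v x < 1) : Valued.v ((1 + x) / (1 - x) - 1) = Valued.v (2 : K) * Valued.v x := by
  rw [cayley_sub_one (one_sub_ne_zero_of_valued_lt_one hx), map_div₀, map_mul, Valuation.map_one_sub_of_lt _ hx, div_one]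

/-- `|(1 + x)∕(1 − x) + 1| = |2|` for `|x| < 1`. [cite: Omeara1963, §63] -/
theorem valued_cayley_add_one {x : K} (hx : Valued.v x < 1) : Valued.v ((1 + x) / (1 - x) + 1) = Valued.v (2 : K) := by
  rw [cayley_add_one (one_sub_ne_zero_of_valued_lt_one hx), map_div₀, Valuation.map_one_sub_of_lt _ hx, div_one]

/-- `|(1 + x)∕(1 − x)| = 1` for `|x| < 1` (the Cayley map lands in the units; indeed in the `1`-units). [cite: Serre1979, Ch. IV §2] -/
theorem valued_cayley_eq_one {x : K} (hx : Valued.v x < 1) : Valued.v ((1 + x) / (1 - x)) = 1 := by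
  rw [map_div₀, Valuation.map_one_add_of_lt _ hx, Valuation.map_one_sub_of_lt _ hx, div_one]

/-- `|(1 + x)∕(1 − x) − 1| < |2|` for `|x| < 1` and `2 ≠ 0`. [cite: Omeara1963, §63] -/
theorem valued_cayley_sub_one_lt_two {x : K} (hx : Valued.v x < 1) (h2 : (2 : K) ≠ 0) :
    Valued.v ((1 + x) / (1 - x) - 1) < Valued.v (2 : K) := by
  rw [valued_cayley_sub_one hx]
  have h2v : Valued.v (2 : K) ≠ 0 := (Valuation.ne_zero_iff _).2 h2
  calc Valued.v (2 : K) * Valued.v x < Valued.v (2 : K) * 1 := mul_lt_mul_of_le_of_lt_of_nonneg_of_pos le_rfl hx zero_le (zero_lt_iff.2 h2v)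
    _ = Valued.v (2 : K) := mul_one _

/-! ## §2 (C2) the inverse `y ↦ (y − 1)∕(y + 1)` on the ball `|y − 1| < |2|` -/

/-- `|y − 1| < |2| ⇒ |y + 1| = |2|` (`y + 1 = 2 + (y − 1)`). [cite: Omeara1963, §63] -/
theorem valued_add_one_eq_two {y : K} (hy : Valued.v (y - 1) < Valued.v (2 : K)) : Valued.v (y + 1) = Valued.v (2 : K) := by
  rw [show y + 1 = 2 + (y - 1) by ring, Valuation.map_add_eq_of_lt_left _ hy]

/-- `|y − 1| < |2| ⇒ y + 1 ≠ 0`. [cite: Omeara1963, §63] -/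
theorem add_one_ne_zero_of_valued_sub_one_lt_two {y : K} (hy : Valued.v (y - 1) < Valued.v (2 : K)) : y + 1 ≠ 0 := fun h0 => by
  have h := valued_add_one_eq_two hy
  rw [h0, map_zero] at h
  rw [← h] at hy
  exact not_lt_zero hy

/-- `|y − 1| < |2| ⇒ 2 ≠ 0`. [cite: Omeara1963, §63] -/
theorem two_ne_zero_of_valued_sub_one_lt_two {y : K} (hy : Valued.v (y - 1) < Valued.v (2 : K)) : (2 : K) ≠ 0 := fun h0 => by
  rw [h0, map_zero] at hy
  exact not_lt_zero hy

/-- **(C2) `|(y − 1)∕(y + 1)| = |y − 1| ∕ |2|`** for `|y − 1| < |2|`: the inverse Cayley map lowers the level by `ord 2`. [cite: Omeara1963, §63] [cite: Serre1979, Ch. IV §2] -/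
theorem valued_invCayley {y : K} (hy : Valued.v (y - 1) < Valued.v (2 : K)) :
    Valued.v ((y - 1) / (y + 1)) = Valued.v (y - 1) / Valued.v (2 : K) := by
  rw [map_div₀, valued_add_one_eq_two hy]

/-- `|(y − 1)∕(y + 1)| < 1` for `|y − 1| < |2|`. [cite: Omeara1963, §63] -/
theorem valued_invCayley_lt_one {y : K} (hy : Valued.v (y - 1) < Valued.v (2 : K)) : Valued.v ((y - 1) / (y + 1)) < 1 := by
  have h2v : (0 : Γ₀) < Valued.v (2 : K) := zero_lt_iff.2 ((Valuation.ne_zero_iff _).2 (two_ne_zero_of_valued_sub_one_lt_two hy))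
  rw [valued_invCayley hy, div_lt_one₀ h2v]
  exact hy

/-- The maps are mutually inverse, I: `(c(x) − 1)∕(c(x) + 1) = x` for `|x| < 1` (`2 ≠ 0`). [cite: Omeara1963, §63] -/
theorem invCayley_cayley_of_valued_lt_one {x : K} (hx : Valued.v x < 1) (h2 : (2 : K) ≠ 0) :
    ((1 + x) / (1 - x) - 1) / ((1 + x) / (1 - x) + 1) = x :=
  invCayley_cayley (one_sub_ne_zero_of_valued_lt_one hx) h2

/-- The maps are mutually inverse, II: `c((y − 1)∕(y + 1)) = y` for `|y − 1| < |2|`. [cite: Omeara1963, §63] -/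
theorem cayley_invCayley_of_valued_sub_one_lt_two {y : K} (hy : Valued.v (y - 1) < Valued.v (2 : K)) :
    (1 + (y - 1) / (y + 1)) / (1 - (y - 1) / (y + 1)) = y :=
  cayley_invCayley (add_one_ne_zero_of_valued_sub_one_lt_two hy) (two_ne_zero_of_valued_sub_one_lt_two hy)

/-! ## §3 (C3) LEVELS: `c` maps `{|x| ≤ r}` bijectively onto `{|y − 1| ≤ |2|·r}` for every `r < 1` -/

/-- `|x| ≤ r < 1 ⇒ |c(x) − 1| ≤ |2|·r`. [cite: Serre1979, Ch. IV §2] [cite: Omeara1963, §63] -/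
theorem valued_cayley_sub_one_le_mul {r : Γ₀} (hr : r < 1) {x : K} (hx : Valued.v x ≤ r) :
    Valued.v ((1 + x) / (1 - x) - 1) ≤ Valued.v (2 : K) * r := by
  rw [valued_cayley_sub_one (hx.trans_lt hr)]
  exact mul_le_mul_right hx _

/-- `|2|·r < |2|` for `r < 1`, `2 ≠ 0`. [cite: Serre1979, Ch. IV §2] -/
theorem valued_two_mul_lt_two {r : Γ₀} (hr : r < 1) (h2 : (2 : K) ≠ 0) : Valued.v (2 : K) * r < Valued.v (2 : K) := by
  have h2v : Valued.v (2 : K) ≠ 0 := (Valuation.ne_zero_iff _).2 h2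
  calc Valued.v (2 : K) * r < Valued.v (2 : K) * 1 := mul_lt_mul_of_le_of_lt_of_nonneg_of_pos le_rfl hr zero_le (zero_lt_iff.2 h2v)
    _ = Valued.v (2 : K) := mul_one _

/-- `|y − 1| ≤ |2|·r`, `r < 1`, `2 ≠ 0` ⇒ `|(y − 1)∕(y + 1)| ≤ r`. [cite: Serre1979, Ch. IV §2] [cite: Omeara1963, §63] -/
theorem valued_invCayley_le_of_le_mul {r : Γ₀} (hr : r < 1) (h2 : (2 : K) ≠ 0) {y : K} (hy : Valued.v (y - 1) ≤ Valued.v (2 : K) * r) :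
    Valued.v ((y - 1) / (y + 1)) ≤ r := by
  have hy' : Valued.v (y - 1) < Valued.v (2 : K) := hy.trans_lt (valued_two_mul_lt_two hr h2)
  have h2v : (0 : Γ₀) < Valued.v (2 : K) := zero_lt_iff.2 ((Valuation.ne_zero_iff _).2 h2)
  rw [valued_invCayley hy', div_le_iff₀ h2v, mul_comm]
  exact hy

/-- `c` maps `{|x| ≤ r}` into `{|y − 1| ≤ |2|·r}` (`r < 1`). [cite: Serre1979, Ch. IV §2] -/
theorem mapsTo_cayley_level {r : Γ₀} (hr : r < 1) :
    Set.MapsTo (fun x : K => (1 + x) / (1 - x)) {x | Valued.v x ≤ r} {y | Valued.v (y - 1) ≤ Valued.v (2 : K) * r} :=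
  fun _ hx => valued_cayley_sub_one_le_mul hr hx

/-- `y ↦ (y − 1)∕(y + 1)` maps `{|y − 1| ≤ |2|·r}` into `{|x| ≤ r}` (`r < 1`, `2 ≠ 0`). [cite: Serre1979, Ch. IV §2] -/
theorem mapsTo_invCayley_level {r : Γ₀} (hr : r < 1) (h2 : (2 : K) ≠ 0) :
    Set.MapsTo (fun y : K => (y - 1) / (y + 1)) {y | Valued.v (y - 1) ≤ Valued.v (2 : K) * r} {x | Valued.v x ≤ r} :=
  fun _ hy => valued_invCayley_le_of_le_mul hr h2 hy

/-- The two maps are inverse to each other on the level sets (`r < 1`, `2 ≠ 0`). [cite: Omeara1963, §63] -/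
theorem invOn_cayley_level {r : Γ₀} (hr : r < 1) (h2 : (2 : K) ≠ 0) :
    Set.InvOn (fun y : K => (y - 1) / (y + 1)) (fun x : K => (1 + x) / (1 - x))
      {x | Valued.v x ≤ r} {y | Valued.v (y - 1) ≤ Valued.v (2 : K) * r} :=
  ⟨fun _ hx => invCayley_cayley_of_valued_lt_one (lt_of_le_of_lt hx hr) h2,
    fun _ hy => cayley_invCayley_of_valued_sub_one_lt_two (lt_of_le_of_lt hy (valued_two_mul_lt_two hr h2))⟩

/-- **(C3) THE CAYLEY LEVEL SHIFT**: for `r < 1` and `2 ≠ 0`, `x ↦ (1 + x)∕(1 − x)` is a BIJECTION from `{x | |x| ≤ r}` onto `{y | |y − 1| ≤ |2|·r}` (inverse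
`y ↦ (y − 1)∕(y + 1)`).  At residue characteristic `2` the level is shifted by `ord 2`; for `|2| = 1` it is preserved (§4). [cite: Omeara1963, §63] [cite: Serre1979, Ch. IV §2] -/
theorem bijOn_cayley_level {r : Γ₀} (hr : r < 1) (h2 : (2 : K) ≠ 0) :
    Set.BijOn (fun x : K => (1 + x) / (1 - x)) {x | Valued.v x ≤ r} {y | Valued.v (y - 1) ≤ Valued.v (2 : K) * r} :=
  (invOn_cayley_level hr h2).bijOn (mapsTo_cayley_level hr) (mapsTo_invCayley_level hr h2)

/-- The image form: `c '' {|x| ≤ r} = {|y − 1| ≤ |2|·r}` (`r < 1`, `2 ≠ 0`). [cite: Omeara1963, §63] -/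
theorem image_cayley_level {r : Γ₀} (hr : r < 1) (h2 : (2 : K) ≠ 0) :
    (fun x : K => (1 + x) / (1 - x)) '' {x | Valued.v x ≤ r} = {y | Valued.v (y - 1) ≤ Valued.v (2 : K) * r} :=
  (bijOn_cayley_level hr h2).image_eq

/-- The inverse bijection: `y ↦ (y − 1)∕(y + 1)` from `{|y − 1| ≤ |2|·r}` onto `{|x| ≤ r}` (`r < 1`, `2 ≠ 0`). [cite: Omeara1963, §63] -/
theorem bijOn_invCayley_level {r : Γ₀} (hr : r < 1) (h2 : (2 : K) ≠ 0) :
    Set.BijOn (fun y : K => (y - 1) / (y + 1)) {y | Valued.v (y - 1) ≤ Valued.v (2 : K) * r} {x | Valued.v x ≤ r} :=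
  (invOn_cayley_level hr h2).symm.bijOn (mapsTo_invCayley_level hr h2) (mapsTo_cayley_level hr)

/-- The BALL version: `x ↦ (1 + x)∕(1 − x)` is a bijection from `{|x| < 1}` onto `{|y − 1| < |2|}` (`2 ≠ 0`). [cite: Omeara1963, §63] [cite: Serre1979, Ch. IV §2] -/
theorem bijOn_cayley_ball (h2 : (2 : K) ≠ 0) :
    Set.BijOn (fun x : K => (1 + x) / (1 - x)) {x | Valued.v x < 1} {y | Valued.v (y - 1) < Valued.v (2 : K)} := by
  refine Set.InvOn.bijOn (f' := fun y : K => (y - 1) / (y + 1)) ⟨fun x hx => ?_, fun y hy => ?_⟩ (fun x hx => ?_) (fun y hy => ?_)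
  · exact invCayley_cayley_of_valued_lt_one hx h2
  · exact cayley_invCayley_of_valued_sub_one_lt_two hy
  · exact valued_cayley_sub_one_lt_two hx h2
  · exact valued_invCayley_lt_one hy

/-! ## §3b (C4) DIFFERENCES: `|c(xᵢ) − c(xⱼ)| = |2|·|xᵢ − xⱼ|` — every root distance is shifted by `ord 2` -/

/-- **(C4) `|c(xᵢ) − c(xⱼ)| = |2|·|xᵢ − xⱼ|`** for `|xᵢ|, |xⱼ| < 1`, `c(x) = (1 + x)∕(1 − x)`: from the 2-free identity `c(xᵢ) − c(xⱼ) = 2(xᵢ − xⱼ)∕((1 − xᵢ)(1 − xⱼ))`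
(★ `Automorphic.cayley_sub_cayley`, used here as a local step) and `|1 − xᵢ| = |1 − xⱼ| = 1` — the dyadic twin of ★ `Automorphic.valued_cayley_sub_cayley` (`|2| = 1`): all
mutual distances, hence all root valuations of a split torus element near `1`, are shifted by `ord 2`. [cite: Omeara1963, §63] [cite: Serre1979, Ch. IV §2] -/
theorem valued_cayley_sub_cayley_of_lt_one {xi xj : K} (hxi : Valued.v xi < 1) (hxj : Valued.v xj < 1) :
    Valued.v ((1 + xi) / (1 - xi) - (1 + xj) / (1 - xj)) = Valued.v (2 : K) * Valued.v (xi - xj) := by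
  have hi := one_sub_ne_zero_of_valued_lt_one hxi
  have hj := one_sub_ne_zero_of_valued_lt_one hxj
  have key : (1 + xi) / (1 - xi) - (1 + xj) / (1 - xj) = 2 * (xi - xj) / ((1 - xi) * (1 - xj)) := by
    field_simp
    ring
  rw [key, map_div₀, map_mul, map_mul, Valuation.map_one_sub_of_lt _ hxi, Valuation.map_one_sub_of_lt _ hxj, mul_one, div_one]

/-- (C4, inverse side) `|(yᵢ − 1)∕(yᵢ + 1) − (yⱼ − 1)∕(yⱼ + 1)| = |yᵢ − yⱼ| ∕ |2|` for `|yᵢ − 1|, |yⱼ − 1| < |2|` (2-free identity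
`(yᵢ−1)∕(yᵢ+1) − (yⱼ−1)∕(yⱼ+1) = 2(yᵢ − yⱼ)∕((yᵢ + 1)(yⱼ + 1))`, ★ `Automorphic.cayleyParam_sub_cayleyParam`, and `|yᵢ + 1| = |yⱼ + 1| = |2|`). [cite: Omeara1963, §63] -/
theorem valued_invCayley_sub_invCayley {yi yj : K} (hyi : Valued.v (yi - 1) < Valued.v (2 : K)) (hyj : Valued.v (yj - 1) < Valued.v (2 : K)) :
    Valued.v ((yi - 1) / (yi + 1) - (yj - 1) / (yj + 1)) = Valued.v (yi - yj) / Valued.v (2 : K) := by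
  have hi := add_one_ne_zero_of_valued_sub_one_lt_two hyi
  have hj := add_one_ne_zero_of_valued_sub_one_lt_two hyj
  have h2 : Valued.v (2 : K) ≠ 0 := (Valuation.ne_zero_iff _).2 (two_ne_zero_of_valued_sub_one_lt_two hyi)
  have key : (yi - 1) / (yi + 1) - (yj - 1) / (yj + 1) = 2 * (yi - yj) / ((yi + 1) * (yj + 1)) := by
    field_simp
    ring
  rw [key, map_div₀, map_mul, map_mul, valued_add_one_eq_two hyi, valued_add_one_eq_two hyj]
  field_simp

/-! ## §3c (C1′)∕(C5) what survives WITHOUT `|2| = 1`: `|x + 1| ≤ max |2| |x − 1|`; a skew `Z` has `|1 − Z| = |1 + Z|`, `= 1` iff `|1 + Z| = 1` -/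

/-- (C1′) In general only `|x + 1| ≤ max (|2|, |x − 1|)` (`x + 1 = 2 + (x − 1)`); equality `= |2|` needs `|x − 1| < |2|` (`valued_add_one_eq_two`), and the tame
`= 1` needs `|2| = 1` (★ `Automorphic.valued_add_one_eq_one`). [cite: Omeara1963, §63] -/
theorem valued_add_one_le_max (x : K) : Valued.v (x + 1) ≤ max (Valued.v (2 : K)) (Valued.v (x - 1)) := by
  rw [show x + 1 = 2 + (x - 1) by ring]
  exact Valuation.map_add _ _ _

/-- **(C5) A SKEW element has `|1 − Z| = |1 + Z|`** under an isometric `σ` with `σ Z = −Z` (`σ(1 − Z) = 1 + Z`) — at ANY residue characteristic; whether this common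
value is `1` is a separate question (next lemma; at `|2| < 1` it fails for `Z ≡ 1`, e.g. `Z = i ∈ ℚ₂(i)`). [cite: Omeara1963, §63] [cite: Serre1979, Ch. V §3] -/
theorem valued_one_sub_eq_valued_one_add_of_map_eq_neg {σ : K →+* K} (hσv : ∀ x, Valued.v (σ x) = Valued.v x) {Z : K} (hσZ : σ Z = -Z) :
    Valued.v (1 - Z) = Valued.v (1 + Z) := by
  rw [← hσv (1 - Z), map_sub, map_one, hσZ, sub_neg_eq_add]

/-- (C5) The honest `iff`: for a skew `Z`, `|1 − Z| = 1 ∧ |1 + Z| = 1 ↔ |1 + Z| = 1` (the tame ★ `Automorphic.valued_one_sub_eq_one_and_of_map_eq_neg` derives the right side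
from `|Z| ≤ 1` and `|2| = 1`; without `|2| = 1` it must be ASSUMED, or obtained from `|Z| < 1` by the next lemma). [cite: Omeara1963, §63] -/
theorem valued_one_sub_eq_one_and_iff_of_map_eq_neg {σ : K →+* K} (hσv : ∀ x, Valued.v (σ x) = Valued.v x) {Z : K} (hσZ : σ Z = -Z) :
    (Valued.v (1 - Z) = 1 ∧ Valued.v (1 + Z) = 1) ↔ Valued.v (1 + Z) = 1 :=
  ⟨fun h => h.2, fun h => ⟨(valued_one_sub_eq_valued_one_add_of_map_eq_neg hσv hσZ).trans h, h⟩⟩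

/-- (C5) The `σ`-free sufficient condition: `|Z| < 1 ⇒ |1 − Z| = 1 ∧ |1 + Z| = 1` (any residue characteristic). [cite: Serre1979, Ch. IV §2] -/
theorem valued_one_sub_and_one_add_eq_one_of_lt_one {Z : K} (hZ : Valued.v Z < 1) : Valued.v (1 - Z) = 1 ∧ Valued.v (1 + Z) = 1 :=
  ⟨Valuation.map_one_sub_of_lt _ hZ, Valuation.map_one_add_of_lt _ hZ⟩

end Valued

/-! ## §4 The `ℤᵐ⁰` dress: level `j` ↔ level `j + e` (`|2| = exp(−e)`), and the tame shape `|2| = 1` -/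

section Discrete

variable {K : Type*} [Field K] [Valued K ℤᵐ⁰]

/-- `1 ≤ j ⇒ exp(−j) < 1` in `ℤᵐ⁰`. [cite: Serre1979, Ch. IV §2] -/
theorem exp_neg_lt_one_of_one_le {j : ℕ} (hj : 1 ≤ j) : exp (-(j : ℤ)) < (1 : ℤᵐ⁰) := by
  rw [← exp_zero, exp_lt_exp]
  omega

/-- `exp(−e)·exp(−j) = exp(−(j + e))`. [cite: Serre1979, Ch. IV §2] -/
theorem exp_neg_mul_exp_neg (e j : ℕ) : exp (-(e : ℤ)) * exp (-(j : ℤ)) = (exp (-((j : ℤ) + e)) : ℤᵐ⁰) := by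
  rw [← exp_add]
  congr 1
  ring

/-- `|2| = exp(−e) ⇒ 2 ≠ 0`. [cite: Omeara1963, §63] -/
theorem two_ne_zero_of_valued_two_eq_exp {e : ℕ} (he : Valued.v (2 : K) = exp (-(e : ℤ))) : (2 : K) ≠ 0 := fun h0 => by
  rw [h0, map_zero] at he
  exact exp_ne_zero he.symm

/-- `|x| ≤ exp(−j)` (`1 ≤ j`), `|2| = exp(−e)` ⇒ `|c(x) − 1| ≤ exp(−(j + e))`: the Cayley map RAISES the level by `e = ord 2`. [cite: Omeara1963, §63] [cite: Serre1979, Ch. IV §2] -/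
theorem valued_cayley_sub_one_le_exp {e : ℕ} (he : Valued.v (2 : K) = exp (-(e : ℤ))) {j : ℕ} (hj : 1 ≤ j) {x : K}
    (hx : Valued.v x ≤ exp (-(j : ℤ))) : Valued.v ((1 + x) / (1 - x) - 1) ≤ exp (-((j : ℤ) + e)) := by
  rw [← exp_neg_mul_exp_neg, ← he]
  exact valued_cayley_sub_one_le_mul (exp_neg_lt_one_of_one_le hj) hx

/-- `|y − 1| ≤ exp(−(j + e))` (`1 ≤ j`), `|2| = exp(−e)` ⇒ `|(y − 1)∕(y + 1)| ≤ exp(−j)`: the inverse map LOWERS the level by `e = ord 2`. [cite: Omeara1963, §63]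
[cite: Serre1979, Ch. IV §2] -/
theorem valued_invCayley_le_exp {e : ℕ} (he : Valued.v (2 : K) = exp (-(e : ℤ))) {j : ℕ} (hj : 1 ≤ j) {y : K}
    (hy : Valued.v (y - 1) ≤ exp (-((j : ℤ) + e))) : Valued.v ((y - 1) / (y + 1)) ≤ exp (-(j : ℤ)) := by
  rw [← exp_neg_mul_exp_neg, ← he] at hy
  exact valued_invCayley_le_of_le_mul (exp_neg_lt_one_of_one_le hj) (two_ne_zero_of_valued_two_eq_exp he) hy

/-- **(C3, `ℤᵐ⁰`) «level `j` ↔ level `j + ord 2`»**: for `|2| = exp(−e)` and `1 ≤ j`, `x ↦ (1 + x)∕(1 − x)` is a bijection from `{|x| ≤ exp(−j)}` onto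
`{|y − 1| ≤ exp(−(j + e))}`, inverse `y ↦ (y − 1)∕(y + 1)`. [cite: Omeara1963, §63] [cite: Serre1979, Ch. IV §2] -/
theorem bijOn_cayley_level_exp {e : ℕ} (he : Valued.v (2 : K) = exp (-(e : ℤ))) {j : ℕ} (hj : 1 ≤ j) :
    Set.BijOn (fun x : K => (1 + x) / (1 - x)) {x | Valued.v x ≤ exp (-(j : ℤ))} {y | Valued.v (y - 1) ≤ exp (-((j : ℤ) + e))} := by
  have h := bijOn_cayley_level (K := K) (exp_neg_lt_one_of_one_le hj) (two_ne_zero_of_valued_two_eq_exp he)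
  rwa [he, exp_neg_mul_exp_neg] at h

/-- The inverse bijection in `ℤᵐ⁰`: `y ↦ (y − 1)∕(y + 1)` from `{|y − 1| ≤ exp(−(j + e))}` onto `{|x| ≤ exp(−j)}` (`|2| = exp(−e)`, `1 ≤ j`). [cite: Omeara1963, §63] -/
theorem bijOn_invCayley_level_exp {e : ℕ} (he : Valued.v (2 : K) = exp (-(e : ℤ))) {j : ℕ} (hj : 1 ≤ j) :
    Set.BijOn (fun y : K => (y - 1) / (y + 1)) {y | Valued.v (y - 1) ≤ exp (-((j : ℤ) + e))} {x | Valued.v x ≤ exp (-(j : ℤ))} := by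
  have h := bijOn_invCayley_level (K := K) (exp_neg_lt_one_of_one_le hj) (two_ne_zero_of_valued_two_eq_exp he)
  rwa [he, exp_neg_mul_exp_neg] at h

/-- **(C4) THE TAME SHAPE `|2| = 1`: `|c(x) − 1| = |x|`** for `|x| < 1` — levels are PRESERVED (the scalar statement behind ★ `SplitTorusCayleyShiftValued` §3 and ★
`MatrixMoebiusShiftLevel`, which carry `|2| = 1`). [cite: Serre1979, Ch. IV §2] -/
theorem valued_cayley_sub_one_of_two (h2 : Valued.v (2 : K) = 1) {x : K} (hx : Valued.v x < 1) :
    Valued.v ((1 + x) / (1 - x) - 1) = Valued.v x := by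
  rw [valued_cayley_sub_one hx, h2, one_mul]

/-- (C4) For `|2| = 1` and `r < 1`, `x ↦ (1 + x)∕(1 − x)` is a bijection from `{|x| ≤ r}` onto `{|y − 1| ≤ r}`. [cite: Serre1979, Ch. IV §2] -/
theorem bijOn_cayley_level_of_two (h2 : Valued.v (2 : K) = 1) {r : ℤᵐ⁰} (hr : r < 1) :
    Set.BijOn (fun x : K => (1 + x) / (1 - x)) {x | Valued.v x ≤ r} {y | Valued.v (y - 1) ≤ r} := by
  have h20 : (2 : K) ≠ 0 := fun h0 => by rw [h0, map_zero] at h2; exact zero_ne_one h2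
  have h := bijOn_cayley_level (K := K) hr h20
  rwa [h2, one_mul] at h

end Discrete

end Literature.NumberTheory.LocalFields
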